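/-
Copyright (c) 2026 the pub-hodgecm-mathlib formalisation cell (harness21).  Prover seat hodgecm-mathlib-LH4-p09 (g3), req620 Track A «(D-RAM) FOUR-FRAME» squad
(unit U3_Laws, κ-STAGE B brick κB-G «GLUED-STRATA κ-SOCKETS», dealer LH4-plan (g11) WORD #32 (3); letter `F0/P3c/LH4/LH4-p09/g3/LETTER-kappaBG-RHS.v1.LH4p09g3.md` §2–§3,
LH4-p05 (g3) «=» 2026-09-04T01:37:11Z).  FILE κG-B1.  2026-09-04.
-/
import Summits.HodgeConjecture.HodgeConjecture.Theorems.F0P3cDyRamDiagonalGluedClassRepresentatives  -- ★ (iv-c) p855927 (LH4-p08 (g2)): `exists_fixed_class_representatives` (exact-level fixed classes, `(q−1)q^{⌈ρ∕2⌉−1}` of them)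
import HarnessLib

/-!
# Crux `H413`, line LH4 «(D-RAM) FOUR-FRAME» road — unit U3_Laws (iii), κ-STAGE B, FILE κG-B1 «SYSTEMS OF REPRESENTATIVES OF FIXED CLASSES»:
# sums over complete irredundant systems, the twisting involution, and the count `q^{⌈ρ∕2⌉}` of the fixed BALL classes

Cell `hodgecm-mathlib` (D-0151), FLOOR 0, crux item H413 = `stmt-HodgeConjecture-24833`, route of record `HCCMUnconditional`; squad F0∕P3c∕LH4 (req618∕req620).  THEOREMS ONLY
(no `def`, no instance, no notation, no `sorry`); lane `--supports stmt-HodgeConjecture-24833 --as helper` (count-neutral).  LAW-FREE bookkeeping.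

WHY.  The κ-twisted census (LH4-p05 (g3) PLAN v1) evaluates, stratum by stratum, sums `Σ_{M} κ_i(M)·w(M)`; on the glued strata these are `mass × Σ_{g ∈ R} κ_i(g)` over a
COMPLETE IRREDUNDANT SYSTEM `R` of representatives of the `σ`-fixed elements of valuation `|ϖ|^{2t}` modulo `𝔭^{ρ+2t}` (★ (iv-a)∕(iv-c), FILE κG-A).  The values `κ_i(g)` are signs
`±ω(g)`, `±ω(1+g)`, `±ω(g)ω(1+g)` (FILE κG-A2), and their sums are CHARACTER SUMS: they vanish by a sign-reversing bijection of the classes (LH4-p06 (g3)'s ★ `sum_normSign_repr_eq_zero`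
is the prototype), except at the boundary `2t = 2d − 2`, where the classes of the exact level must be compared with the classes of the whole BALL `{|x| ≤ |ϖ|^{2t}}`, whose number is
`q^{⌈ρ∕2⌉}`.  This file is the class-bookkeeping for FILE κG-B2: a «system of representatives of `A` modulo `r`» is a finite `S ⊆ A` with (complete) every `f ∈ A` within `r` of some
`g ∈ S` and (irredundant) distinct members of `S` at distance `> r` — spelled out in every head, no `def`.
* §1 `sum_eq_sum_of_repr`, `card_eq_card_of_repr` — a class function has the same sum over any two systems; two systems have the same size.
* §2 `sum_eq_zero_of_twist` — if `τ : A → A` is distance-non-increasing modulo `r` and `F ∘ τ = −F` for a class function `F`, then `Σ_{S} F = 0` (★ p06 §5's argument, `ω ↦ F`, `c· ↦ τ`).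
* §3 `v_le_pow_succ_succ_of_fixed_of_v_lt` — a fixed element of valuation `< |ϖ|^{2t}` has valuation `≤ |ϖ|^{2t+2}` (parity).
* §4 **`exists_repr_fixedBall_card`** — a system of representatives of the fixed BALL `{x = σx, |x| ≤ |ϖ|^{2t}}` modulo `𝔭^{ρ+2t}` with EXACTLY `q^{⌈ρ∕2⌉}` members (two-step
  recursion on `ρ`: the ball is the exact level `|x| = |ϖ|^{2t}` — ★ (iv-c), `(q−1)q^{⌈ρ∕2⌉−1}` classes — plus the ball of level `2t+2`, whose classes modulo `𝔭^{ρ+2t} = 𝔭^{(ρ−2)+2(t+1)}`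
  are the case `(ρ−2, t+1)`; `ρ ∈ {0, 1}`: the deep part is one class).
HONEST LABEL.  Count-neutral (`--supports`); nothing printed is asserted; (KMS)∕(KSS) stay PROVER TARGETS; `HC_CM` is proved only modulo the 7 printed citations (2 remaining named inputs:
hLiu418 = `stmt-HodgeConjecture-24832`, h413 = `stmt-HodgeConjecture-24833`) until rung 0 closes.

## References
* [Serre1979] J.-P. Serre, *Local Fields*, GTM 67 (1979), Ch. IV §2 Prop. 6 (the filtration counts), Ch. V §3 Prop. 5, Cor. 3 (the fixed field of a ramified quadratic datum).
* [Kottwitz1986BaseChangeUnits] R. E. Kottwitz, *Base change for unit elements of Hecke algebras*, Compositio Math. 60 (1986), §1 pp. 240–241 (lattice counts by residue classes).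
-/

set_option autoImplicit false

noncomputable section

namespace Summit.HodgeConjecture.HodgeConjecture.Cruxes.H413.F0P3cDyRamDiagonalFixedClassSystems

open WithZero
open Literature.NumberTheory.LocalFields.WildQuadraticDatum
open Summit.HodgeConjecture.HodgeConjecture.Cruxes.H413.F0P3cDyRamDiagonalGluedClassRepresentatives (exists_fixed_class_representatives)
open scoped Valued

variable {K : Type*} [Field K] [Valued K ℤᵐ⁰]

/-! ## §1  Sums and sizes do not depend on the system of representatives -/

/-- **THE REPRESENTATIVE MAP BETWEEN TWO SYSTEMS IS A BIJECTION**: given two complete irredundant systems `S, S′` of `A` modulo `r`, the map `g ↦ rep_{S′}(g)` is a bijection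
`S → S′` respecting classes; hence a CLASS FUNCTION `F` has `Σ_S F = Σ_{S′} F`. [cite: Serre1979, Ch. IV §2 Prop. 6] [cite: Kottwitz1986BaseChangeUnits, §1 pp. 240–241] -/
theorem sum_eq_sum_of_repr {A : Set K} {r : ℤᵐ⁰} (S S' : Finset K)
    (hS1 : ∀ g ∈ S, g ∈ A) (hS2 : ∀ f ∈ A, ∃ g ∈ S, Valued.v (f - g) ≤ r) (hS3 : ∀ g ∈ S, ∀ g' ∈ S, Valued.v (g - g') ≤ r → g = g')
    (hS'1 : ∀ g ∈ S', g ∈ A) (hS'2 : ∀ f ∈ A, ∃ g ∈ S', Valued.v (f - g) ≤ r) (hS'3 : ∀ g ∈ S', ∀ g' ∈ S', Valued.v (g - g') ≤ r → g = g')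
    (F : K → ℤ) (hF : ∀ f ∈ A, ∀ f' ∈ A, Valued.v (f - f') ≤ r → F f = F f') :
    ∑ g ∈ S, F g = ∑ g ∈ S', F g := by
  classical
  choose! φ hφS hφ using fun g (hg : g ∈ S) => hS'2 g (hS1 g hg)
  choose! ψ hψS hψ using fun g (hg : g ∈ S') => hS2 g (hS'1 g hg)
  have hdist : ∀ a b c : K, Valued.v (a - b) ≤ r → Valued.v (b - c) ≤ r → Valued.v (a - c) ≤ r := fun a b c h1 h2 => by
    rw [show a - c = (a - b) + (b - c) by ring]; exact Valuation.map_add_le _ h1 h2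
  have hsymm : ∀ a b : K, Valued.v (a - b) ≤ r → Valued.v (b - a) ≤ r := fun a b h => by rwa [Valuation.map_sub_swap]
  refine Finset.sum_bij (fun g _ => φ g) (fun g hg => hφS g hg) (fun g₁ hg₁ g₂ hg₂ h => ?_) (fun g' hg' => ?_) (fun g hg => ?_)
  · -- injective: `g₁ ≡ φ g₁ = φ g₂ ≡ g₂`
    exact hS3 g₁ hg₁ g₂ hg₂ (hdist _ _ _ (hφ g₁ hg₁) (by rw [h]; exact hsymm _ _ (hφ g₂ hg₂)))
  · -- surjective: `φ (ψ g′) = g′`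
    refine ⟨ψ g', hψS g' hg', hS'3 _ (hφS _ (hψS g' hg')) g' hg' ?_⟩
    exact hsymm _ _ (hdist _ _ _ (hψ g' hg') (hφ _ (hψS g' hg')))
  · exact hF g (hS1 g hg) (φ g) (hS'1 _ (hφS g hg)) (hφ g hg)

/-- **TWO SYSTEMS OF REPRESENTATIVES HAVE THE SAME SIZE.** [cite: Serre1979, Ch. IV §2 Prop. 6] -/
theorem card_eq_card_of_repr {A : Set K} {r : ℤᵐ⁰} (S S' : Finset K)
    (hS1 : ∀ g ∈ S, g ∈ A) (hS2 : ∀ f ∈ A, ∃ g ∈ S, Valued.v (f - g) ≤ r) (hS3 : ∀ g ∈ S, ∀ g' ∈ S, Valued.v (g - g') ≤ r → g = g')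
    (hS'1 : ∀ g ∈ S', g ∈ A) (hS'2 : ∀ f ∈ A, ∃ g ∈ S', Valued.v (f - g) ≤ r) (hS'3 : ∀ g ∈ S', ∀ g' ∈ S', Valued.v (g - g') ≤ r → g = g') :
    S.card = S'.card := by
  have h := sum_eq_sum_of_repr S S' hS1 hS2 hS3 hS'1 hS'2 hS'3 (fun _ => 1) (fun _ _ _ _ _ => rfl)
  simpa using h

/-! ## §2  The twisting involution: a sign-reversing self-map of the classes kills the sum -/

/-- **`Σ_{S} F = 0` BY A SIGN-REVERSING TWIST** (★ LH4-p06 (g3) `sum_normSign_repr_eq_zero`'s argument, made generic): `S` a complete irredundant system of `A` modulo `r`, `F` a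
class function, `τ : A → A` with `|τf − τf′| ≤ r ⇒ |f − f′| ≤ r` and `F(τ f) = −F(f)`; then `g ↦ rep(τ g)` is a bijection of `S` flipping `F`, so `Σ_S F = −Σ_S F`.
[cite: Serre1979, Ch. V §3 Prop. 5, Cor. 3] [cite: Kottwitz1986BaseChangeUnits, §1 pp. 240–241] -/
theorem sum_eq_zero_of_twist {A : Set K} {r : ℤᵐ⁰} (S : Finset K)
    (hS1 : ∀ g ∈ S, g ∈ A) (hS2 : ∀ f ∈ A, ∃ g ∈ S, Valued.v (f - g) ≤ r) (hS3 : ∀ g ∈ S, ∀ g' ∈ S, Valued.v (g - g') ≤ r → g = g')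
    (F : K → ℤ) (hF : ∀ f ∈ A, ∀ f' ∈ A, Valued.v (f - f') ≤ r → F f = F f')
    (τ : K → K) (hτA : ∀ f ∈ A, τ f ∈ A) (hτ : ∀ f ∈ A, ∀ f' ∈ A, Valued.v (τ f - τ f') ≤ r → Valued.v (f - f') ≤ r) (hflip : ∀ f ∈ A, F (τ f) = -F f) :
    ∑ g ∈ S, F g = 0 := by
  classical
  choose! φ hφS hφ using fun g (hg : g ∈ S) => hS2 (τ g) (hτA g (hS1 g hg))
  have hdist : ∀ a b c : K, Valued.v (a - b) ≤ r → Valued.v (b - c) ≤ r → Valued.v (a - c) ≤ r := fun a b c h1 h2 => by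
    rw [show a - c = (a - b) + (b - c) by ring]; exact Valuation.map_add_le _ h1 h2
  have hsymm : ∀ a b : K, Valued.v (a - b) ≤ r → Valued.v (b - a) ≤ r := fun a b h => by rwa [Valuation.map_sub_swap]
  have hflip' : ∀ g ∈ S, F (φ g) = -F g := fun g hg => by
    rw [← hF (τ g) (hτA g (hS1 g hg)) (φ g) (hS1 _ (hφS g hg)) (hφ g hg), hflip g (hS1 g hg)]
  have hinj : ∀ g₁ ∈ S, ∀ g₂ ∈ S, φ g₁ = φ g₂ → g₁ = g₂ := fun g₁ hg₁ g₂ hg₂ heq =>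
    hS3 g₁ hg₁ g₂ hg₂ (hτ g₁ (hS1 g₁ hg₁) g₂ (hS1 g₂ hg₂)
      (hdist _ _ _ (hφ g₁ hg₁) (by rw [heq]; exact hsymm _ _ (hφ g₂ hg₂))))
  have hsum : ∑ g ∈ S, F (φ g) = ∑ g ∈ S, F g :=
    Finset.sum_bij (fun g _ => φ g) (fun g hg => hφS g hg) (fun g₁ hg₁ g₂ hg₂ h => hinj g₁ hg₁ g₂ hg₂ h)
      (fun g' hg' => by
        have himg : S.image φ = S := Finset.eq_of_subset_of_card_le (Finset.image_subset_iff.2 fun g hg => hφS g hg)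
          (by rw [Finset.card_image_of_injOn (fun g₁ hg₁ g₂ hg₂ h => hinj g₁ hg₁ g₂ hg₂ h)])
        have hg'' : g' ∈ S.image φ := by rw [himg]; exact hg'
        obtain ⟨g, hg, hgg'⟩ := Finset.mem_image.1 hg''
        exact ⟨g, hg, hgg'⟩)
      (fun _ _ => rfl)
  have hneg : ∑ g ∈ S, F (φ g) = -∑ g ∈ S, F g := by
    rw [← Finset.sum_neg_distrib]; exact Finset.sum_congr rfl hflip'
  have h2 : (2 : ℤ) * ∑ g ∈ S, F g = 0 := by linarith
  simpa using h2

/-! ## §3  Parity: below the exact level a fixed element drops two steps -/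

/-- A fixed `f` with `|f| < |ϖ|^{2t}` has `|f| ≤ |ϖ|^{2t+2}` (fixed non-zero elements have EVEN valuation). [cite: Serre1979, Ch. V §3 Prop. 5, Cor. 3] -/
theorem v_le_pow_succ_succ_of_fixed_of_v_lt {σ : K →+* K} (hfix : ∀ x : K, σ x = x → x ≠ 0 → ∃ n : ℤ, Valued.v x = exp (2 * n))
    {ϖ : K} (hϖ : Valued.v ϖ = exp (-1 : ℤ)) (t : ℕ) {f : K} (hσf : σ f = f) (hf : Valued.v f < Valued.v ϖ ^ (2 * t)) :
    Valued.v f ≤ Valued.v ϖ ^ (2 * t + 2) := by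
  rcases eq_or_ne f 0 with rfl | hf0
  · rw [map_zero]; exact zero_le
  obtain ⟨n, hn⟩ := hfix f hσf hf0
  rw [hn, v_varpi_pow hϖ, exp_lt_exp] at hf
  rw [hn, v_varpi_pow hϖ, exp_le_exp]
  push_cast at hf ⊢
  omega


/-! ## §4  The fixed ball `{x = σx, |x| ≤ |ϖ|^{2t}}` modulo `𝔭^{ρ+2t}` has `q^{⌈ρ∕2⌉}` classes -/

/-- **A SYSTEM OF REPRESENTATIVES OF THE FIXED BALL OF LEVEL `2t` MODULO `𝔭^{ρ+2t}`, WITH `q^{⌈ρ∕2⌉}` MEMBERS** (`q = #𝓀`; ramified quadratic datum letters `hσ hvσ hfix hϖ hd`, finite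
residue field): by two-step recursion on `ρ` — the ball is the exact level (★ (iv-c): `(q−1)q^{⌈ρ∕2⌉−1}` classes for `ρ ≥ 1`) ⊔ the ball of level `2t+2`, whose classes modulo
`𝔭^{ρ+2t} = 𝔭^{(ρ−2)+2(t+1)}` are the case `(ρ−2, t+1)` (one class for `ρ ≤ 1`).  `[𝒪_F : 𝔭_F^{⌈ρ∕2⌉}] = q^{⌈ρ∕2⌉}` in class currency. [cite: Serre1979, Ch. IV §2 Prop. 6] -/
theorem exists_repr_fixedBall_card {σ : K →+* K} {ϖ : K} {d : ℕ} (hσ : ∀ x, σ (σ x) = x) (hvσ : ∀ a, Valued.v (σ a) = Valued.v a)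
    (hfix : ∀ x : K, σ x = x → x ≠ 0 → ∃ n : ℤ, Valued.v x = exp (2 * n)) (hϖ : Valued.v ϖ = exp (-1 : ℤ))
    (hd : Valued.v (ϖ - σ ϖ) = Valued.v ϖ ^ d) [Finite 𝓀[K]] (ρ t : ℕ) :
    ∃ S : Finset K, (∀ g ∈ S, σ g = g ∧ Valued.v g ≤ Valued.v ϖ ^ (2 * t)) ∧
      (∀ f : K, σ f = f → Valued.v f ≤ Valued.v ϖ ^ (2 * t) → ∃ g ∈ S, Valued.v (f - g) ≤ Valued.v ϖ ^ (ρ + 2 * t)) ∧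
      (∀ g ∈ S, ∀ g' ∈ S, Valued.v (g - g') ≤ Valued.v ϖ ^ (ρ + 2 * t) → g = g') ∧ S.card = Nat.card 𝓀[K] ^ ((ρ + 1) / 2) := by
  classical
  have hϖ0 : ϖ ≠ 0 := fun h0 => by rw [h0, map_zero] at hϖ; exact WithZero.coe_ne_zero hϖ.symm
  have hvϖ : 0 < Valued.v ϖ := (Valuation.pos_iff _).2 hϖ0
  have hϖ1 : Valued.v ϖ < 1 := by rw [hϖ, ← exp_zero, exp_lt_exp]; norm_num
  have hmono : ∀ {a b : ℕ}, a ≤ b → Valued.v ϖ ^ b ≤ Valued.v ϖ ^ a := fun h => pow_le_pow_right_of_le_one' hϖ1.le h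
  -- the one-class system `{0}` when the modulus does not exceed the level
  have hzero : ∀ (t m : ℕ), m ≤ 2 * t → ∃ S : Finset K, (∀ g ∈ S, σ g = g ∧ Valued.v g ≤ Valued.v ϖ ^ (2 * t)) ∧
      (∀ f : K, σ f = f → Valued.v f ≤ Valued.v ϖ ^ (2 * t) → ∃ g ∈ S, Valued.v (f - g) ≤ Valued.v ϖ ^ m) ∧
      (∀ g ∈ S, ∀ g' ∈ S, Valued.v (g - g') ≤ Valued.v ϖ ^ m → g = g') ∧ S.card = 1 := by
    intro t m hm
    refine ⟨{0}, fun g hg => ?_, fun f _ hf => ⟨0, Finset.mem_singleton_self 0, ?_⟩, fun g hg g' hg' _ => ?_, Finset.card_singleton 0⟩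
    · rw [Finset.mem_singleton.1 hg, map_zero, map_zero]; exact ⟨rfl, zero_le⟩
    · rw [sub_zero]; exact hf.trans (hmono hm)
    · rw [Finset.mem_singleton.1 hg, Finset.mem_singleton.1 hg']
  induction ρ using Nat.strong_induction_on generalizing t with
  | _ ρ ih =>
  rcases Nat.eq_zero_or_pos ρ with rfl | hρ
  · -- `ρ = 0`: one class
    obtain ⟨S, h1, h2, h3, h4⟩ := hzero t (0 + 2 * t) (by omega)
    exact ⟨S, h1, h2, h3, by rw [h4]; simp⟩
  -- `ρ ≥ 1`: the DEEP part (level `2t + 2`, modulus `ρ + 2t`)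
  have hdeep : ∃ D : Finset K, (∀ g ∈ D, σ g = g ∧ Valued.v g ≤ Valued.v ϖ ^ (2 * (t + 1))) ∧
      (∀ f : K, σ f = f → Valued.v f ≤ Valued.v ϖ ^ (2 * (t + 1)) → ∃ g ∈ D, Valued.v (f - g) ≤ Valued.v ϖ ^ (ρ + 2 * t)) ∧
      (∀ g ∈ D, ∀ g' ∈ D, Valued.v (g - g') ≤ Valued.v ϖ ^ (ρ + 2 * t) → g = g') ∧ D.card = Nat.card 𝓀[K] ^ ((ρ - 1) / 2) := by
    rcases Nat.lt_or_ge ρ 2 with hρ2 | hρ2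
    · obtain ⟨D, h1, h2, h3, h4⟩ := hzero (t + 1) (ρ + 2 * t) (by omega)
      exact ⟨D, h1, h2, h3, by rw [h4, show (ρ - 1) / 2 = 0 by omega, pow_zero]⟩
    · obtain ⟨D, h1, h2, h3, h4⟩ := ih (ρ - 2) (by omega) (t + 1)
      have e : ρ - 2 + 2 * (t + 1) = ρ + 2 * t := by omega
      rw [e] at h2 h3
      exact ⟨D, h1, h2, h3, by rw [h4]; congr 1; omega⟩
  obtain ⟨D, hD1, hD2, hD3, hD4⟩ := hdeep
  -- the EXACT part (★ (iv-c))
  obtain ⟨R, hRfin, hRcard, hR1, hR2, hR3⟩ := exists_fixed_class_representatives hσ hvσ hfix hϖ hd ρ t hρ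
  set E : Finset K := hRfin.toFinset with hE
  have hmemE : ∀ g, g ∈ E ↔ g ∈ R := fun g => Set.Finite.mem_toFinset hRfin
  have hEcard : E.card = (Nat.card 𝓀[K] - 1) * Nat.card 𝓀[K] ^ ((ρ + 1) / 2 - 1) := by
    rw [hE, ← Set.ncard_eq_toFinset_card R hRfin]; exact hRcard
  -- exact and deep classes are far apart
  have hlt : Valued.v ϖ ^ (ρ + 2 * t) < Valued.v ϖ ^ (2 * t) := pow_lt_pow_right_of_lt_one₀ hvϖ hϖ1 (by omega)
  have hfar : ∀ g ∈ E, ∀ g' ∈ D, ¬ Valued.v (g - g') ≤ Valued.v ϖ ^ (ρ + 2 * t) := by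
    intro g hg g' hg' hle
    have hvg := (hR1 g ((hmemE g).1 hg)).2
    have hvg' : Valued.v g' < Valued.v g := by
      rw [hvg]; exact (hD1 g' hg').2.trans_lt (pow_lt_pow_right_of_lt_one₀ hvϖ hϖ1 (by omega))
    have heq : Valued.v (g - g') = Valued.v g := Valuation.map_sub_eq_of_lt_left _ hvg'
    rw [heq, hvg] at hle
    exact absurd hle (not_le.2 hlt)
  have hdisj : Disjoint E D := by
    rw [Finset.disjoint_left]
    intro g hg hg'
    exact hfar g hg g hg' (by rw [sub_self, map_zero]; exact zero_le)
  refine ⟨E ∪ D, fun g hg => ?_, fun f hσf hf => ?_, fun g hg g' hg' hgg' => ?_, ?_⟩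
  · -- members
    rcases Finset.mem_union.1 hg with hg | hg
    · obtain ⟨h1, h2⟩ := hR1 g ((hmemE g).1 hg); exact ⟨h1, h2.le⟩
    · obtain ⟨h1, h2⟩ := hD1 g hg; exact ⟨h1, h2.trans (hmono (by omega))⟩
  · -- completeness
    rcases hf.lt_or_eq with hlt' | heq
    · obtain ⟨g, hg, hfg⟩ := hD2 f hσf (by rw [show 2 * (t + 1) = 2 * t + 2 by ring]; exact v_le_pow_succ_succ_of_fixed_of_v_lt hfix hϖ t hσf hlt')
      exact ⟨g, Finset.mem_union_right _ hg, hfg⟩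
    · obtain ⟨g, hg, hfg⟩ := hR2 f hσf heq
      exact ⟨g, Finset.mem_union_left _ ((hmemE g).2 hg), hfg⟩
  · -- irredundance
    rcases Finset.mem_union.1 hg with hg | hg <;> rcases Finset.mem_union.1 hg' with hg' | hg'
    · exact hR3 g ((hmemE g).1 hg) g' ((hmemE g').1 hg') hgg'
    · exact absurd hgg' (hfar g hg g' hg')
    · exact absurd (by rwa [Valuation.map_sub_swap]) (hfar g' hg' g hg)
    · exact hD3 g hg g' hg' hgg'
  · -- count: `(q−1)q^{⌈ρ∕2⌉−1} + q^{⌈ρ∕2⌉−1} = q^{⌈ρ∕2⌉}`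
    rw [Finset.card_union_of_disjoint hdisj, hEcard, hD4]
    have h1 : 1 ≤ Nat.card 𝓀[K] := Nat.one_le_iff_ne_zero.2 Nat.card_pos.ne'
    have e1 : (ρ + 1) / 2 - 1 = (ρ - 1) / 2 := by omega
    have e2 : (ρ + 1) / 2 = (ρ - 1) / 2 + 1 := by omega
    rw [e1, e2, pow_succ]
    zify [h1]
    ring

end Summit.HodgeConjecture.HodgeConjecture.Cruxes.H413.F0P3cDyRamDiagonalFixedClassSystems

end
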